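import Summits.QuantumAdvantage.QuantumAdvantage.Theorems.RateDialA
import HarnessLib
import HarnessLib.Audit

/-!
# RateDial, part B/2: the NODE EQUATIONS on the registered items of route ScaleDial
(`mesoHi3_iff_rate : Theses.ScaleDial.MesoHi3 ↔ MesoW3 ∧ ExpUnif3`, `mesoLift3_iff_rate`, `massStep3u_iff_rate`), the
cell-by-cell octic floor `octLoss3_of_qFracW3`, the constant-degree rungs `QCRung d` (`qcRung_one` PROVED; `QCRung 2` the
first open rung, below DegreeDial's 24215), the one-polynomial sufficient form `expUnif3_of_cov`, necessity, the kill
structure, and the deciding theorems `closes_mesoHi3` / `closes_mesoLift3` / `closes_26533` / `closes` (leaf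
`AdviceFreeQNC0Three` BY NAME via `ScaleDial.closes₄`) — support for item stmt-QuantumAdvantage-26910

Cell decomp-qadv, seat lens-1 («grading / quantitative ladder»), generation 13 — land port of §E–§C of the node «RateDial»
(HOME/decomp-qadv-lens-1/g13/RateDial.lean, NODE-g13.md); lands AFTER part A (linear chain A → B).  The node file with
ONLY the namespace renamed and split at a section boundary.  Prop-defs = the node's pieces / rungs only (`MesoW3`,
`MesoWAt`, `TopLiftW3`, `QFracConst`, `QCRung`, `CovQFracDeg`, `CovQFracW3`, `CovExpUnif3`).  No `sorry`, no new axioms,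
no instances, no notation.
-/

set_option linter.dupNamespace false
set_option linter.style.longLine false

noncomputable section

open scoped Classical

namespace Summit.QuantumAdvantage.QuantumAdvantage.Theorems.RateDial

open Finset
open Literature.Computability.QuantumComplexity Literature.Computability.QuantumComplexity.RingHLF
open Literature.Computability.MetaComplexity Literature.Computability.MetaComplexity.Smolensky
open Summit.QuantumAdvantage.AdviceFreeQNC0
open Summit.QuantumAdvantage.QuantumAdvantage.Theses.ExactnessDial (NoPerfectOdd3 PolyLossOddU3 MassStep3u OddToAll3
  DPLift3 ExactDegreeLogIO3)
open Summit.QuantumAdvantage.QuantumAdvantage.Theorems.ScaleDial (losers winners QML3 QFracU3 CovQFracU3 MesoLift3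
  MesoLiftExact3 TopLift3 oct OctLoss3 MesoLo3 MesoHi3 NoPerfectQuarter3 NoPerfectSqrt3 winners_card_eq losers_card_le
  qFracU3_of_polyLossOddU3 logpow_add_logpow_le qml3_of_qFracU3 noPerfectOdd3_of_qml3 noPerfectOdd3_of_qFracU3
  polyLossOddU3_of_ringHardOdd3 oct_le_sqrt qml3_of_octLoss3 octLoss3_of_qFracU3 mesoLift3_iff_oct massStep3u_iff_three
  three_of_polyLossOddU3 closes₄ octLoss3_of_noPerfectQuarter3 mesoLo3_of_noPerfectQuarter3 noPerfectOdd3_iff_qml3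
  cov_of_qFracU3 qFracU3_of_cov)
open Summit.QuantumAdvantage.QuantumAdvantage.Theorems.RingPeriodFold (cov covStrat covStrat_mem_lowDeg)
open Summit.QuantumAdvantage.QuantumAdvantage.Theorems.RingSymmetrization3 (filter_cov_eq)

/-! ## §E  The octic floor, cell by cell (tree: ScaleDial part D `oct`, `OctLoss3`, `MesoLo3`, `MesoHi3`)

`OctLoss3` (`2^(n^{1/8})` odd losses at every polylog degree), `MesoLo3 := QML3 → OctLoss3` (item 26909) and the
BLOCKER `MesoHi3 := OctLoss3 → QFracU3` (item 26910, the registered residual of route ScaleDial) are the TREE's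
(`Theorems.ScaleDial`, part D); the registered item texts are their inlinings (`item_mesoHi3_iff` etc., `Iff.rfl`).
New here: the comparison `QFracDeg c B ⟹ octic losses at degree exponent c` CELL BY CELL (`octLoss3_of_qFracDeg`), whence
the NON-UNIFORM aggregate already gives the floor (`octLoss3_of_qFracW3`) — the observation that makes the cut exact. -/

/-- junction: the registered residual 26910 IS the tree's `MesoHi3`. -/
theorem item_mesoHi3_iff : Theses.ScaleDial.MesoHi3 ↔ MesoHi3 := Iff.rfl

/-- junction: item 26909 IS the tree's `MesoLo3`. -/
theorem item_mesoLo3_iff : Theses.ScaleDial.MesoLo3 ↔ MesoLo3 := Iff.rfl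

/-- junction: item 26905 IS the tree's `TopLift3`. -/
theorem item_topLift3_iff : Theses.ScaleDial.TopLift3 ↔ TopLift3 := Iff.rfl

/-- junction: item 26906 IS the tree's `MesoLift3`. -/
theorem item_mesoLift3_iff : Theses.ScaleDial.MesoLift3 ↔ MesoLift3 := Iff.rfl

/-- RateDialB helper `noPerfectOdd3_of_octLoss3` (decomp-qadv land package; see the module docstring). -/
theorem noPerfectOdd3_of_octLoss3 (h : OctLoss3) : NoPerfectOdd3 := noPerfectOdd3_of_qml3 (qml3_of_octLoss3 h)

/-- CELL BY CELL: `QFracDeg c B` gives the octic loss count at degree exponent `c`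
(a `2^{−(log₂ n)^B}` fraction of `2^(n−1)` exceeds `2^(n^{1/8})`; the per-cell form of ScaleDial's
`octLoss3_of_qFracU3`). -/
theorem octLoss3_of_qFracDeg {c B : ℕ} (h : QFracDeg c B) :
    ∃ n₀ : ℕ, ∀ n ≥ n₀, ∀ P : Fin n → CubeFn (ZMod 3) n,
      (∀ i, P i ∈ lowDeg (ZMod 3) n ((Nat.log 2 n) ^ c)) → 2 ^ (oct n) ≤ (losers n P).card := by
  obtain ⟨n₀, hn₀⟩ := h
  refine ⟨max n₀ (2 ^ (2 ^ (B + B + 2)) + 16), fun n hn P hP => ?_⟩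
  have h1 := hn₀ n (le_trans (le_max_left _ _) hn) P hP
  have hmax : 2 ^ (2 ^ (B + B + 2)) + 16 ≤ n := le_trans (le_max_right _ _) hn
  have hb0 : 1 ≤ 2 ^ (2 ^ (B + B + 2)) := Nat.one_le_two_pow
  have hnbig : 2 ^ (2 ^ (B + B + 2)) ≤ n := by omega
  have hn16 : 16 ≤ n := by omega
  have hn1 : 1 ≤ n := by omega
  set L := Nat.log 2 n with hL
  have hsum' : L ^ B + L ^ B ≤ n - 1 := logpow_add_logpow_le hnbig
  have hs4 : 4 ≤ Nat.sqrt n := Nat.le_sqrt.2 (by omega)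
  have hss : Nat.sqrt n * Nat.sqrt n ≤ n := Nat.sqrt_le n
  have hsq : 4 * Nat.sqrt n ≤ n := le_trans (Nat.mul_le_mul_right (Nat.sqrt n) hs4) hss
  have hos : oct n ≤ Nat.sqrt n := oct_le_sqrt n
  have hsum : oct n + L ^ B ≤ n - 1 := by omega
  have hw := winners_card_eq hn1 P
  have hl := losers_card_le hn1 P
  have hwR : ((winners n P).card : ℝ) = (2 : ℝ) ^ (n - 1) - (losers n P).card := by
    rw [hw, Nat.cast_sub hl]; push_cast; ring
  rw [hwR] at h1
  have h2pos : (0 : ℝ) < (2 : ℝ) ^ (L ^ B) := pow_pos (by norm_num) _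
  have h2 : (2 : ℝ) ^ (n - 1) / (2 : ℝ) ^ (L ^ B) ≤ (losers n P).card := by
    have : (2 : ℝ) ^ (n - 1) / (2 : ℝ) ^ (L ^ B) = (1 / (2 : ℝ) ^ (L ^ B)) * (2 : ℝ) ^ (n - 1) := by ring
    rw [this]; nlinarith
  have h3 : (2 : ℝ) ^ (oct n) ≤ (2 : ℝ) ^ (n - 1) / (2 : ℝ) ^ (L ^ B) := by
    rw [le_div_iff₀ h2pos, ← pow_add]
    exact pow_le_pow_right₀ (by norm_num) hsum
  exact_mod_cast h3.trans h2

/-- the NON-UNIFORM aggregate already gives the octic rung: `QFracW3 → OctLoss3` (no uniformity needed — this is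
what makes the cut of `MesoHi3` exact). -/
theorem octLoss3_of_qFracW3 (h : QFracW3) : OctLoss3 := fun c => by
  obtain ⟨B, hB⟩ := h c; exact octLoss3_of_qFracDeg hB

/-- RateDialB helper `octLoss3_of_qFracU3` (decomp-qadv land package; see the module docstring). -/
theorem octLoss3_of_qFracU3 (h : QFracU3) : OctLoss3 := octLoss3_of_qFracW3 (qFracW3_of_qFracU3 h)

/-! ## §M  The pieces of this node -/

/-- **MesoW3 — THE NON-UNIFORM MESOSCOPIC LIFT** [W · T-implied (`pieces_of_polyLossOddU3`) · strictly below
`MesoHi3` (`(mesoHi3_iff_rate).1`; the converse would prove `ExpUnif3`) · UNDECIDED · GRADED by the degree exponent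
`c` (`mesoW3_iff_graded`): cell `c = 0` PROVED outright (`mesoWAt_zero`, from `AffBells37`), cells `c ≥ 1`
IDEA-NEEDED (the AffBells37 slicing needs a sparse low-weight character sum, which fails for `ω^{quadratic}`;
`c = 1` is degree `log₂ n`, adjacent to `Literature.Barriers.QuantumAdvantage.NonclassicalDegreeLogBarrier`)]:
`2^(n^{1/8})` losses at every polylog degree ⟹ every degree exponent has SOME quasi-polynomial loss exponent. -/
def MesoW3 : Prop := OctLoss3 → QFracW3

/-- one cell of `MesoW3`. -/
def MesoWAt (c : ℕ) : Prop := OctLoss3 → ∃ B : ℕ, QFracDeg c B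

/-- RateDialB helper `mesoW3_iff_graded` (decomp-qadv land package; see the module docstring). -/
theorem mesoW3_iff_graded : MesoW3 ↔ ∀ c : ℕ, MesoWAt c :=
  ⟨fun h c hO => h hO c, fun h hO c => h c hO⟩

/-- **RUNG**: the cell `c = 0` of `MesoW3` holds (unconditionally — its conclusion is `qFracW3_zero`). -/
theorem mesoWAt_zero : MesoWAt 0 := fun _ => qFracW3_zero

/-! (the BOTTOM half is route ScaleDial's registered item 26909 `MesoLo3 := QML3 → OctLoss3` — ATTACKABLE through
the landed edge `octLoss3_of_noPerfectQuarter3` (tree, part E); it is used BY NAME below and not re-cut here.) -/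

/-- the top lift absorbed with uniformity: `TopLiftW3 := QFracW3 → PolyLossOddU3` (`= ExpUnif3 ∧ TopLift3`). -/
def TopLiftW3 : Prop := QFracW3 → PolyLossOddU3

/-! ## §Q  Between cell 0 and cell 1: the CONSTANT-DEGREE rungs (`d = 1` PROVED; `d = 2` the FIRST OPEN RUNG)

Cell `c = 0` is 𝔽₃-degree `(log₂ n)^0 = 1`; cell `c = 1` is degree `log₂ n`.  Every CONSTANT degree `d ≥ 2` sits strictly
between them: `QCRung d := ∃ B, QFracConst d B` (SOME quasi-polynomial loss-fraction exponent against strategies of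
𝔽₃-degree `≤ d`).  `QCRung 1` is the proved cell 0 (`qcRung_one`); cell 1 dominates every constant rung
(`qcRung_of_cellOne`); `QCRung 2` — quadratic strategies — is the first open rung of the W-ladder, WEAKER than
DegreeDial's θ-level aside `QuadraticHardOdd3` (24215; `qcRung_two_of_quadraticHardOdd3`) and the place where the
degree-2 census (data/rate-census-v0.md) measures the rate directly. -/

/-- the constant-degree cell `(d, B)`. -/
def QFracConst (d B : ℕ) : Prop :=
  ∃ n₀ : ℕ, ∀ n ≥ n₀, ∀ P : Fin n → CubeFn (ZMod 3) n,
    (∀ i, P i ∈ lowDeg (ZMod 3) n d) →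
      ((winners n P).card : ℝ) ≤ (1 - 1 / (2 : ℝ) ^ ((Nat.log 2 n) ^ B)) * (2 : ℝ) ^ (n - 1)

/-- **`QCRung d` — the constant-degree rung**: some quasi-polynomial loss exponent against 𝔽₃-degree-`d` strategies. -/
def QCRung (d : ℕ) : Prop := ∃ B : ℕ, QFracConst d B

/-- RateDialB helper `qFracConst_anti` (decomp-qadv land package; see the module docstring). -/
theorem qFracConst_anti {d d' B : ℕ} (h : d ≤ d') (hq : QFracConst d' B) : QFracConst d B := by
  obtain ⟨n₀, hn₀⟩ := hq
  exact ⟨n₀, fun n hn P hP => hn₀ n hn P fun i => lowDeg_mono h (hP i)⟩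

/-- RateDialB helper `qcRung_anti` (decomp-qadv land package; see the module docstring). -/
theorem qcRung_anti {d d' : ℕ} (h : d ≤ d') (hq : QCRung d') : QCRung d :=
  hq.imp fun _ hB => qFracConst_anti h hB

/-- rung 1 IS cell 0. -/
theorem qFracConst_one_iff (B : ℕ) : QFracConst 1 B ↔ QFracDeg 0 B := by
  simp only [QFracConst, QFracDeg, pow_zero]

/-- ★ rung 1 PROVED (affine strategies; `qFracW3_zero`). -/
theorem qcRung_one : QCRung 1 := by
  obtain ⟨B, hB⟩ := qFracW3_zero
  exact ⟨B, (qFracConst_one_iff B).2 hB⟩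

/-- cell 1 (degree `log₂ n`) dominates every constant degree (`d ≤ log₂ n` once `2^d ≤ n`). -/
theorem qFracConst_of_qFracDeg_one {B : ℕ} (h : QFracDeg 1 B) (d : ℕ) : QFracConst d B := by
  obtain ⟨n₀, hn₀⟩ := h
  refine ⟨max n₀ (2 ^ d), fun n hn P hP => hn₀ n (le_trans (le_max_left _ _) hn) P fun i => lowDeg_mono ?_ (hP i)⟩
  rw [pow_one]
  exact Nat.le_log_of_pow_le (by norm_num) (le_trans (le_max_right _ _) hn)

/-- RateDialB helper `qcRung_of_cellOne` (decomp-qadv land package; see the module docstring). -/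
theorem qcRung_of_cellOne (h : ∃ B : ℕ, QFracDeg 1 B) (d : ℕ) : QCRung d :=
  h.imp fun _ hB => qFracConst_of_qFracDeg_one hB d

/-- every constant rung is a consequence of the non-uniform aggregate (hence of `QFracU3`, `PolyLossOddU3`, `T`). -/
theorem qcRung_of_qFracW3 (h : QFracW3) (d : ℕ) : QCRung d := qcRung_of_cellOne (h 1) d

/-- … and of the W-cell `c = 1` given the octic floor. -/
theorem qcRung_of_mesoWAt_one (h : MesoWAt 1) (hO : OctLoss3) (d : ℕ) : QCRung d := qcRung_of_cellOne (h hO) d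

/-- the quadratic rung from DegreeDial's θ-level aside `QuadraticHardOdd3` (item 24215): constant loss fraction at
degree 2 ⟹ `1/n` ⟹ `2^(−(log₂ n)^2)`. -/
theorem qcRung_two_of_quadraticHardOdd3 (h : Theses.DegreeDial.QuadraticHardOdd3) : QCRung 2 := by
  obtain ⟨θ, hθ, n₀, hn₀⟩ := h
  obtain ⟨n₁, hn₁⟩ := polyBound_of_thetaBound hθ
  refine ⟨2, max (max n₀ n₁) 4, fun n hn P hP => ?_⟩
  have hn' : max n₀ n₁ ≤ n := le_trans (le_max_left _ _) hn
  exact (hn₀ n (le_trans (le_max_left _ _) hn') P hP).trans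
    ((hn₁ n (le_trans (le_max_right _ _) hn')).trans (quasiBound_of_polyBound 1 (le_trans (le_max_right _ _) hn)))

/-! ## §N  The node equations (all EXACT; stated on the REGISTERED items of route ScaleDial) -/

/-- **NODE EQUATION AT THE BLOCKER** (item 26910, the registered residual): `MesoHi3 ⟺ MesoW3 ∧ ExpUnif3`. -/
theorem mesoHi3_iff_rate : Theses.ScaleDial.MesoHi3 ↔ (MesoW3 ∧ ExpUnif3) := by
  rw [item_mesoHi3_iff]
  constructor
  · intro hHi
    exact ⟨fun hO => qFracW3_of_qFracU3 (hHi hO), fun hW => hHi (octLoss3_of_qFracW3 hW)⟩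
  · rintro ⟨hW, hU⟩ hO
    exact hU (hW hO)

/-- **NODE EQUATION AT THE PARENT RESIDUAL** (item 26906): `MesoLift3 ⟺ MesoLo3 ∧ MesoW3 ∧ ExpUnif3`
(ScaleDial's glued split `mesoLift3_iff_oct` refined in its upper child). -/
theorem mesoLift3_iff_rate : Theses.ScaleDial.MesoLift3 ↔ (Theses.ScaleDial.MesoLo3 ∧ MesoW3 ∧ ExpUnif3) := by
  rw [item_mesoLift3_iff, item_mesoLo3_iff, mesoLift3_iff_oct, ← item_mesoHi3_iff, mesoHi3_iff_rate]

/-- the exactness-keyed reading (tree `MesoLiftExact3 := NoPerfectOdd3 → QFracU3`; absorption law `noPerfectOdd3_iff_qml3`). -/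
theorem mesoLiftExact3_iff_rate : MesoLiftExact3 ↔ ((NoPerfectOdd3 → OctLoss3) ∧ MesoW3 ∧ ExpUnif3) := by
  constructor
  · intro hA
    refine ⟨fun hN => octLoss3_of_qFracU3 (hA hN), fun hO => qFracW3_of_qFracU3 (hA (noPerfectOdd3_of_octLoss3 hO)),
      fun hW => hA (noPerfectOdd3_of_octLoss3 (octLoss3_of_qFracW3 hW))⟩
  · rintro ⟨hLo, hW, hU⟩ hN
    exact hU (hW (hLo hN))

/-- **NODE EQUATION AT THE GRANDPARENT 26533**: `MassStep3u ⟺ MesoLo3 ∧ MesoW3 ∧ ExpUnif3 ∧ TopLift3`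
(ScaleDial's three-piece cut `massStep3u_iff_three` with its middle piece cut once more). -/
theorem massStep3u_iff_rate : MassStep3u ↔ (Theses.ScaleDial.MesoLo3 ∧ MesoW3 ∧ ExpUnif3 ∧ Theses.ScaleDial.TopLift3) := by
  rw [item_mesoLo3_iff, item_topLift3_iff, massStep3u_iff_three, ← item_mesoHi3_iff, mesoHi3_iff_rate]
  simp only [and_assoc]

/-- the top lift with uniformity absorbed: `TopLiftW3 ⟺ ExpUnif3 ∧ TopLift3`. -/
theorem topLiftW3_iff : TopLiftW3 ↔ (ExpUnif3 ∧ Theses.ScaleDial.TopLift3) := by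
  rw [item_topLift3_iff]
  exact ⟨fun h => ⟨fun hW => qFracU3_of_polyLossOddU3 (h hW), fun hQ => h (qFracW3_of_qFracU3 hQ)⟩,
    fun h hW => h.2 (h.1 hW)⟩

/-- the coarsest reading: `(OctLoss3 → PolyLossOddU3) ⟺ MesoW3 ∧ ExpUnif3 ∧ TopLift3` — the `2 × 2` square
{meso, top} × {non-uniform, uniformity} of the upper lift has exactly three independent corners. -/
theorem upperLift_iff_rate : (OctLoss3 → PolyLossOddU3) ↔ (MesoW3 ∧ ExpUnif3 ∧ Theses.ScaleDial.TopLift3) := by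
  rw [item_topLift3_iff]
  constructor
  · intro h
    refine ⟨fun hO => qFracW3_of_qFracU3 (qFracU3_of_polyLossOddU3 (h hO)),
      fun hW => qFracU3_of_polyLossOddU3 (h (octLoss3_of_qFracW3 hW)),
      fun hQ => h (octLoss3_of_qFracU3 hQ)⟩
  · rintro ⟨hW, hU, hT⟩ hO
    exact hT (hU (hW hO))

/-! ## §V  The residual's ONE-POLYNOMIAL sufficient form (covariant uniformity ⟹ uniformity)

Cell by cell, restriction to rotation-covariant strategies is free (`covQFracDeg_of_qFracDeg`), but the converse
symmetrisation (ScaleDial's `qFracU3_of_cov`) elects a leader at degree cost `(log₂ n)^{2·max B 2 + 2}` depending on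
the LOSS exponent `B` — so it is available for the UNIFORM aggregate `QFracU3` and NOT cell by cell for `QFracW3`
(the rate function may outrun the headroom).  Consequence: uniformity for ONE covariant polynomial's rate function
IMPLIES `ExpUnif3` (`expUnif3_of_cov`) — a sufficient one-polynomial form of the residual — while the exact covariant
reading is not claimed. -/

/-- one covariant cell: eventually every rotation-covariant strategy `x ↦ (b ↦ [Q(rot_b x) = 1])` of degree
`≤ (log₂ n)^c` wins at most `(1 − 2^{−(log₂ n)^B})·2^(n−1)` odd patterns. -/
def CovQFracDeg (c B : ℕ) : Prop :=
  ∃ n₀ : ℕ, ∀ n ≥ n₀, ∀ Q : CubeFn (ZMod 3) n,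
    Q ∈ lowDeg (ZMod 3) n ((Nat.log 2 n) ^ c) →
      ((univ.filter fun x : Fin n → Bool => OddZeros x ∧ RingHLF.Rel x (cov Q x)).card : ℝ) ≤
        (1 - 1 / (2 : ℝ) ^ ((Nat.log 2 n) ^ B)) * (2 : ℝ) ^ (n - 1)

/-- the covariant rate function is everywhere finite / bounded. -/
def CovQFracW3 : Prop := ∀ c : ℕ, ∃ B : ℕ, CovQFracDeg c B

/-- RateDialB helper `covQFracU3_iff_deg` (decomp-qadv land package; see the module docstring). -/
theorem covQFracU3_iff_deg : Theorems.ScaleDial.CovQFracU3 ↔ ∃ B : ℕ, ∀ c : ℕ, CovQFracDeg c B := Iff.rfl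

/-- **CovExpUnif3** — uniformity of the loss exponent for ONE rotation-covariant polynomial [T-implied
(`covExpUnif3_of_polyLossOddU3`) · implies `ExpUnif3` (`expUnif3_of_cov`) · UNDECIDED]. -/
def CovExpUnif3 : Prop := CovQFracW3 → Theorems.ScaleDial.CovQFracU3

/-- restriction, cell by cell (same exponents). -/
theorem covQFracDeg_of_qFracDeg {c B : ℕ} (h : QFracDeg c B) : CovQFracDeg c B := by
  obtain ⟨n₀, hn₀⟩ := h
  refine ⟨n₀, fun n hn Q hQ => ?_⟩
  rw [filter_cov_eq]
  exact hn₀ n hn (covStrat Q) (covStrat_mem_lowDeg hQ)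

/-- RateDialB helper `covQFracW3_of_qFracW3` (decomp-qadv land package; see the module docstring). -/
theorem covQFracW3_of_qFracW3 (h : QFracW3) : CovQFracW3 := fun c => by
  obtain ⟨B, hB⟩ := h c; exact ⟨B, covQFracDeg_of_qFracDeg hB⟩

/-- **the one-polynomial sufficient form of the residual**: `CovExpUnif3 → ExpUnif3`
(restriction cell by cell, then ScaleDial's quasi-polynomial symmetrisation `qFracU3_of_cov` on the uniform side). -/
theorem expUnif3_of_cov (h : CovExpUnif3) : ExpUnif3 := fun hW =>
  Theorems.ScaleDial.qFracU3_of_cov (h (covQFracW3_of_qFracW3 hW))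

/-- RateDialB helper `covExpUnif3_of_polyLossOddU3` (decomp-qadv land package; see the module docstring). -/
theorem covExpUnif3_of_polyLossOddU3 (h : PolyLossOddU3) : CovExpUnif3 := fun _ =>
  Theorems.ScaleDial.cov_of_qFracU3 (qFracU3_of_polyLossOddU3 h)

/-! ## §T  Necessity: every piece is implied by the target currency (`PolyLossOddU3`, hence by `RingHardOdd 3`) -/

/-- RateDialB helper `pieces_of_polyLossOddU3` (decomp-qadv land package; see the module docstring). -/
theorem pieces_of_polyLossOddU3 (h : PolyLossOddU3) :
    Theses.ScaleDial.MesoLo3 ∧ MesoW3 ∧ ExpUnif3 ∧ Theses.ScaleDial.TopLift3 := by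
  rw [item_mesoLo3_iff, item_topLift3_iff]
  exact ⟨(three_of_polyLossOddU3 h).1, fun _ => qFracW3_of_qFracU3 (qFracU3_of_polyLossOddU3 h),
    fun _ => qFracU3_of_polyLossOddU3 h, fun _ => h⟩

/-- RateDialB helper `pieces_of_ringHardOdd3` (decomp-qadv land package; see the module docstring). -/
theorem pieces_of_ringHardOdd3 (h : RingHardOdd 3) :
    Theses.ScaleDial.MesoLo3 ∧ MesoW3 ∧ ExpUnif3 ∧ Theses.ScaleDial.TopLift3 :=
  pieces_of_polyLossOddU3 (polyLossOddU3_of_ringHardOdd3 h)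

/-- the uniformity pieces at the other two storeys are `T`-implied as well. -/
theorem unif_of_ringHardOdd3 (h : RingHardOdd 3) : ThetaUnif3 ∧ PolyUnif3 ∧ ExpUnif3 :=
  ⟨fun _ => h, fun _ => polyLossOddU3_of_ringHardOdd3 h,
    fun _ => qFracU3_of_polyLossOddU3 (polyLossOddU3_of_ringHardOdd3 h)⟩

/-! ## §K  Kill structure: what refutes a LIFT piece, and what does not

The registered kill lane of the rung, `ExactDegreeLogIO3` (27433: perfect strategies of degree `C·log₂ n` infinitely
often), refutes `T` but CONFIRMS every piece of this node — vacuously, because it denies their common floor `OctLoss3`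
(`pieces_of_exactDegreeLogIO3`).  A lift piece dies only INSIDE the hard world: `¬ExpUnif3 ⟺ QFracW3 ∧ ¬QFracU3`
(`not_expUnif3_iff`: the rate function finite everywhere and unbounded) — which is what the rate census instruments. -/

/-- RateDialB helper `not_octLoss3_of_exactDegreeLogIO3` (decomp-qadv land package; see the module docstring). -/
theorem not_octLoss3_of_exactDegreeLogIO3 (h : ExactDegreeLogIO3) : ¬ OctLoss3 := by
  intro hO
  obtain ⟨C, hC⟩ := h
  obtain ⟨n₀, hn₀⟩ := hO 2
  obtain ⟨n, hn, P, hP, hwin⟩ := hC (max n₀ (2 ^ (C + 1)))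
  have hn₀' : n₀ ≤ n := le_trans (le_max_left _ _) hn
  have hnC : 2 ^ (C + 1) ≤ n := le_trans (le_max_right _ _) hn
  have hL : C + 1 ≤ Nat.log 2 n := Nat.le_log_of_pow_le (by norm_num) hnC
  have hdeg : C * Nat.log 2 n ≤ (Nat.log 2 n) ^ 2 := by
    rw [pow_two]; exact Nat.mul_le_mul_right _ (by omega)
  have hP2 : ∀ i, P i ∈ lowDeg (ZMod 3) n ((Nat.log 2 n) ^ 2) := fun i => lowDeg_mono hdeg (hP i)
  have h1 := hn₀ n hn₀' P hP2
  have hempty : losers n P = ∅ := by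
    ext x
    simp only [losers, mem_filter, mem_univ, true_and, Finset.notMem_empty, iff_false, not_and, not_not]
    exact hwin x
  rw [hempty, Finset.card_empty] at h1
  exact absurd h1 (by have := Nat.one_le_two_pow (n := oct n); omega)

/-- RateDialB helper `not_noPerfectOdd3_of_exactDegreeLogIO3` (decomp-qadv land package; see the module docstring). -/
theorem not_noPerfectOdd3_of_exactDegreeLogIO3 (h : ExactDegreeLogIO3) : ¬ NoPerfectOdd3 := by
  intro hN
  obtain ⟨C, hC⟩ := h
  obtain ⟨n₀, hn₀⟩ := hN 2
  obtain ⟨n, hn, P, hP, hwin⟩ := hC (max n₀ (2 ^ (C + 1)))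
  have hn₀' : n₀ ≤ n := le_trans (le_max_left _ _) hn
  have hnC : 2 ^ (C + 1) ≤ n := le_trans (le_max_right _ _) hn
  have hL : C + 1 ≤ Nat.log 2 n := Nat.le_log_of_pow_le (by norm_num) hnC
  have hdeg : C * Nat.log 2 n ≤ (Nat.log 2 n) ^ 2 := by
    rw [pow_two]; exact Nat.mul_le_mul_right _ (by omega)
  obtain ⟨x, hx, hnot⟩ := hn₀ n hn₀' P fun i => lowDeg_mono hdeg (hP i)
  exact hnot (hwin x hx)

/-- **the kill lane 27433 confirms all four pieces of 26533 (vacuously) while refuting `T`.** -/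
theorem pieces_of_exactDegreeLogIO3 (h : ExactDegreeLogIO3) :
    Theses.ScaleDial.MesoLo3 ∧ MesoW3 ∧ ExpUnif3 ∧ Theses.ScaleDial.TopLift3 := by
  rw [item_mesoLo3_iff, item_topLift3_iff]
  exact ⟨fun hQ => absurd (noPerfectOdd3_of_qml3 hQ) (not_noPerfectOdd3_of_exactDegreeLogIO3 h),
    fun hO => absurd hO (not_octLoss3_of_exactDegreeLogIO3 h),
    fun hW => absurd (octLoss3_of_qFracW3 hW) (not_octLoss3_of_exactDegreeLogIO3 h),
    fun hQ => absurd (octLoss3_of_qFracU3 hQ) (not_octLoss3_of_exactDegreeLogIO3 h)⟩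
/-- what a SUBSTANTIVE refutation of the residual looks like: the rate function finite everywhere, unbounded. -/
theorem not_expUnif3_iff : ¬ ExpUnif3 ↔ (QFracW3 ∧ ¬ QFracU3) := by
  unfold ExpUnif3; tauto
/-- and of the non-uniform lift: the octic floor holds but some degree exponent has NO loss exponent. -/
theorem not_mesoW3_iff : ¬ MesoW3 ↔ (OctLoss3 ∧ ∃ c : ℕ, ∀ B : ℕ, ¬ QFracDeg c B) := by
  unfold MesoW3 QFracW3
  push Not
  rfl

/-! ## §C  Deciding theorems (BY NAME) -/
/-- the registered residual 26910 from its two pieces. -/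
theorem closes_mesoHi3 (hW : MesoW3) (hU : ExpUnif3) : Theses.ScaleDial.MesoHi3 := mesoHi3_iff_rate.2 ⟨hW, hU⟩
/-- the parent residual 26906 from 26909 and the two pieces (ScaleDial's glue `MesoLift3Glue`, item 26911, refined). -/
theorem closes_mesoLift3 (hLo : Theses.ScaleDial.MesoLo3) (hW : MesoW3) (hU : ExpUnif3) : Theses.ScaleDial.MesoLift3 :=
  mesoLift3_iff_rate.2 ⟨hLo, hW, hU⟩
/-- item 26533 from the four pieces. -/
theorem closes_26533 (hLo : Theses.ScaleDial.MesoLo3) (hW : MesoW3) (hU : ExpUnif3) (hT : Theses.ScaleDial.TopLift3) : MassStep3u :=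
  massStep3u_iff_rate.2 ⟨hLo, hW, hU, hT⟩
/-- **`closes`** — the leaf `AdviceFreeQNC0Three` BY NAME (tree `ScaleDial.closes₄`) from ExactnessDial's exactness crux
`NoPerfectOdd3` (26532), ScaleDial's `MesoLo3` (26909) and `TopLift3` (26905), THIS NODE's two pieces `MesoW3`, `ExpUnif3`
(which replace the registered residual `MesoHi3`, 26910), and ProductDial's residual `DPLift3` (26124); `OddToAll3`
(26534, CLOSED) is discharged by name. -/
theorem closes (hN : NoPerfectOdd3) (hLo : Theses.ScaleDial.MesoLo3) (hW : MesoW3) (hU : ExpUnif3) (hT : Theses.ScaleDial.TopLift3)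
    (hD : DPLift3) : Summit.QuantumAdvantage.AdviceFreeQNC0.AdviceFreeQNC0Three :=
  closes₄ hN (item_mesoLo3_iff.1 hLo) (item_mesoHi3_iff.1 (closes_mesoHi3 hW hU)) (item_topLift3_iff.1 hT)
    Theorems.ExactnessDialOddToAll.exactnessDial_oddToAll3 hD

/-! §G axiom audit (`#guard_msgs in #print axioms` for closes, massStep3u_iff_rate, mesoHi3_iff_rate, qFracW3_zero, pieces_of_ringHardOdd3 — all
[propext, Classical.choice, Quot.sound]) lives in the lens node g13/RateDial.lean and the critic check chk/RT.lean; omitted here to keep the part ≤ 400 lines. -/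

end Summit.QuantumAdvantage.QuantumAdvantage.Theorems.RateDial

end
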